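import Literature.Claims.NS.Tyhtila2007
import HarnessLib

/-!
# C50 `Tyhtila2007` — kernel certificate for the NS-claims sweep (D-0090), refuter-8

Typed record: `Literature.Claims.NS.Tyhtila2007` (typist-8 g2, p482915), J. I. Tyhtilä, arXiv 0707.1976 v5,
§4 pp.5–11: an explicit complex-valued triple (u, p, f) offered as an «analytical solution» of the forced
system (3)–(5).

Kernel facts (sorry-free, standard axioms; port of typist-8 g2's kill-aid under landing convention (b)):

* `sys60_holds`, `step5_explicit6062_holds` — the system (60)–(62) pp.9–10 with the cross terms (63)–(68),
  the force (72)–(74) and the pressure (78) holds identically (`ring`): Step 5 is true.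
* `not_Step_4_chooseBackwards` — the passage (58)–(62) «choose backwards» is false: (60)–(62) do NOT give
  back the substituted system (55)–(57), because the viscous/time remainder `ν·[(ix−x)² + (iy−y)² + (iz−z)²
  + 4(i−1)]·u_k` is dropped. Witness `ν = 1`, `(α, β, γ) = (1, −1, 0)`, point `(x, y, z, t) = (0, 1, 1, 0)`:
  the cross and force terms of the x-equation vanish there and (55) would read `0 = 8i·E ≠ 0`.
* `not_remainderVanishes_everywhere` — the same fact through the typist's equivalence
  `step4_iff_remainderVanishes`.

WHAT THIS IS NOT: not a claim about NS regularity or blow-up; not a claim about any author beyond the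
typed locator.
-/

set_option linter.dupNamespace false

noncomputable section

open Complex
open Literature.Claims.NS.Tyhtila2007

namespace Summit.NavierStokesRegularity.NavierStokesRegularity.Theorems.Tyhtila2007

/-- The system (60)–(62) holds identically for the explicit fields (63)–(78), for every `ν` and all
complex amplitudes. [cite: Tyhtila2007, (60)–(62) pp.9–10; (63)–(78) pp.10–11] -/
theorem sys60_holds (ν : ℝ) (α β γ : ℂ) : Sys60 ν α β γ := by
  intro x y z t _
  unfold crossX crossY crossZ fx fy fz
  exact ⟨by ring, by ring, by ring⟩

/-- Hence Step 5 (§4.4 (63)–(78) pp.10–11) holds as typed. [cite: Tyhtila2007, (63)–(78) pp.10–11] -/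
theorem step5_explicit6062_holds : Step_5_explicit6062 :=
  fun ν _ α β γ _ => sys60_holds ν α β γ

/-- The dropped x-remainder at the test point: `bracket 0 1 1 · u_x(1,1;0,1,1,0) = 8 i · E(1;0,1,1,0)`.
[cite: Tyhtila2007, (55) p.9] -/
theorem remainder_at_point :
    ((1 : ℝ) : ℂ) * bracket 0 1 1 * ux 1 1 0 1 1 0 = 8 * I * E 1 0 1 1 0 := by
  unfold bracket ux
  push_cast
  linear_combination (2 * I ^ 2 - 4 * I - 2) * E 1 0 1 1 0 * Complex.I_sq

/-- **«Choose backwards» (58)–(62) pp.9–10 is false (C50)**: (60)–(62) hold for `ν = 1`,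
`(α, β, γ) = (1, −1, 0)` while the x-equation of (55) fails at `(x, y, z, t) = (0, 1, 1, 0)` (`0 = 8i·E`,
`E ≠ 0`). [cite: Tyhtila2007, (58)–(62) pp.9–10] -/
theorem not_Step_4_chooseBackwards : ¬ Literature.Claims.NS.Tyhtila2007.Step_4_chooseBackwards := by
  intro h4
  have h55 : Sys55 1 1 (-1) 0 :=
    h4 1 one_pos 1 (-1) 0 (by norm_num) (sys60_holds 1 1 (-1) 0)
  obtain ⟨hx, -, -⟩ := h55 0 1 1 0 le_rfl
  have hE : E 1 0 1 1 0 ≠ 0 := Complex.exp_ne_zero _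
  have hI : (8 : ℂ) * I ≠ 0 := mul_ne_zero (by norm_num) Complex.I_ne_zero
  have hzero : (8 : ℂ) * I * E 1 0 1 1 0 = 0 := by
    have hc : crossX 1 1 (-1) 0 0 1 1 0 = 0 := by unfold crossX; push_cast; ring
    have hf : fx 1 1 (-1) 0 0 1 1 0 = 0 := by unfold fx; push_cast; ring
    rw [hc, hf, sub_zero, add_zero, remainder_at_point] at hx
    have : (4 : ℂ) * ((0 : ℝ) : ℂ) * g 1 0 1 1 0 = 0 := by push_cast; ring
    rw [this] at hx
    exact hx.symm
  exact (mul_ne_zero hI hE) hzero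

/-- The same kill through the typist's equivalence `step4_iff_remainderVanishes`: the dropped remainder
does not vanish everywhere. [cite: Tyhtila2007, (55)–(62) pp.9–10] -/
theorem not_remainderVanishes_everywhere :
    ¬ (∀ ν : ℝ, 0 < ν → ∀ α β γ : ℂ, α + β + γ = 0 →
        ∀ x y z t : ℝ, 0 ≤ t → RemainderVanishes ν α β γ x y z t) := by
  intro h
  exact not_Step_4_chooseBackwards ((step4_iff_remainderVanishes step5_explicit6062_holds).mpr h)

end Summit.NavierStokesRegularity.NavierStokesRegularity.Theorems.Tyhtila2007

end
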